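import Mathlib.Topology.Sets.VietorisTopology
import Mathlib.Topology.MetricSpace.Closeds
import Mathlib.MeasureTheory.Measure.Prokhorov
import Mathlib.MeasureTheory.Measure.Portmanteau
import Literature.Probability.RandomPlanarGeometry.SeparatedTraces
import Literature.MeasureTheory.RandomSets.AvoidanceFunctional

/-!
# Crux `HexConjecture` (stmt-CriticalPhenomena-0808), line `root-locality-replaces-loewner`,
stub `stub_rangeIdentification`: hyperspace compactness, relative compactness of laws of random
compact sets, and the portmanteau inequalities (part 1a)

Landing target:
`Summits/CriticalPhenomena/SAWScalingLimit/Theorems/SAWDevelopingMapHexConjectureRangeIdentificationHyperspace.lean`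
(`--supports stmt-CriticalPhenomena-0808`).

The registered stub `stub_rangeIdentification` (`HexAvoidanceCocycle → HexRangeLimit`) identifies
the scaling limit of the RANGE of the critical hexagonal self-avoiding walk, a random point of the
hyperspace `NonemptyCompacts ℂ` (Vietoris topology = Hausdorff-metric topology), WITHOUT any
tightness estimate: all ranges lie in the compact set `closure D`, hence their laws live on the
compact subset `{K | K ⊆ closure D}` of the hyperspace (Blaschke; Mathlib's
`NonemptyCompacts.isCompact_subsets_of_isCompact`) and are relatively compact by Prokhorov's
theorem.  This file supplies the measure-theoretic, lattice-free part of that argument: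

* `continuous_rangeNC` — the trace map `CurveClass ℂ → NonemptyCompacts ℂ` is continuous
  (`1`-Lipschitz for the Hausdorff distance, `CurveClass.hausdorffDist_range_le_dist`);
* `isClosed_setOf_isPreconnected` — connected compact sets form a CLOSED subset of the hyperspace
  (a disconnected compact set splits into two compact pieces with disjoint open neighbourhoods,
  and so does every compact set Hausdorff-close to it);
* `exists_tendsto_subseq_of_measure_compl_eq_zero` — probability measures on a separable metric
  space all carried by ONE compact set have weakly convergent subsequences (tightness for free +
  Prokhorov, Mathlib's `isCompact_closure_of_isTightMeasureSet`, + metrisability of weak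
  convergence, Lévy–Prokhorov);
* `le_measure_of_tendsto_of_isClosed`, `measure_le_of_tendsto_of_isOpen` — the two portmanteau
  inequalities in the form "eventual bounds along the sequence pass to the weak limit"
  (Mathlib's `ProbabilityMeasure.limsup_measure_closed_le_of_tendsto`,
  `ProbabilityMeasure.le_liminf_measure_open_of_tendsto`);
* `measure_eq_one_of_tendsto_of_isClosed`, `ae_mem_coe_of_tendsto` — closed sure events of the
  approximants are almost sure for the limit; in particular "`K` meets every closed ball about
  points `p_n → p`" gives `p ∈ K` almost surely.

References: P. Billingsley, *Convergence of probability measures*, 2nd ed. (1999), Thm. 2.1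
(portmanteau), Thm. 5.1 (Prokhorov); I. Molchanov, *Theory of Random Sets* (2005), App. C
(myopic = Hausdorff topology on compact sets).
-/

noncomputable section

namespace Summit.CriticalPhenomena.SAWScalingLimit.Theorems.HexConjecture.RootLocality.Range

open scoped Topology NNReal ENNReal
open Filter Set MeasureTheory TopologicalSpace Metric
open Literature.Probability.RandomPlanarGeometry

/-! ### The trace map into the hyperspace -/

/-- **The trace map `CurveClass ℂ → NonemptyCompacts ℂ` is `1`-Lipschitz** for the Hausdorff
distance (Aizenman–Burchard 1999, §2.1). [cite: AizenmanBurchardDuke1999, §2.1] -/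
theorem dist_rangeNC_le (c c' : CurveClass ℂ) :
    dist (⟨⟨c.range, c.isCompact_range⟩, c.range_nonempty⟩ : NonemptyCompacts ℂ)
      ⟨⟨c'.range, c'.isCompact_range⟩, c'.range_nonempty⟩ ≤ dist c c' := by
  rw [Metric.NonemptyCompacts.dist_eq]
  exact CurveClass.hausdorffDist_range_le_dist c c'

/-- **The trace map `CurveClass ℂ → NonemptyCompacts ℂ` is continuous** (Vietoris = Hausdorff
topology on the hyperspace). [cite: AizenmanBurchardDuke1999, §2.1] -/
theorem continuous_rangeNC :
    Continuous (fun c : CurveClass ℂ =>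
      (⟨⟨c.range, c.isCompact_range⟩, c.range_nonempty⟩ : NonemptyCompacts ℂ)) :=
  (LipschitzWith.mk_one fun c c' => dist_rangeNC_le c c').continuous

/-! ### Connected compact sets form a closed subset of the hyperspace -/

section Connected

variable {α : Type*} [MetricSpace α]

/-- **A compact set which is not preconnected splits into two nonempty compact disjoint
pieces.** [folklore] -/
theorem exists_isCompact_union_of_not_isPreconnected {K : Set α} (hK : IsCompact K)
    (h : ¬ IsPreconnected K) :
    ∃ K₁ K₂ : Set α, IsCompact K₁ ∧ IsCompact K₂ ∧ Disjoint K₁ K₂ ∧ K = K₁ ∪ K₂ ∧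
      K₁.Nonempty ∧ K₂.Nonempty := by
  rw [isPreconnected_iff_subset_of_disjoint_closed] at h
  push Not at h
  obtain ⟨A, B, hA, hB, hKAB, hdisj, hKA, hKB⟩ := h
  refine ⟨K ∩ A, K ∩ B, hK.inter_right hA, hK.inter_right hB, ?_, ?_, ?_, ?_⟩
  · rw [Set.disjoint_iff_inter_eq_empty]
    refine Set.eq_empty_of_subset_empty fun x hx => ?_
    have : x ∈ K ∩ (A ∩ B) := ⟨hx.1.1, hx.1.2, hx.2.2⟩
    rw [hdisj] at this
    exact this
  · rw [← Set.inter_union_distrib_left]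
    exact (Set.inter_eq_left.2 hKAB).symm
  · obtain ⟨x, hxK, hxB⟩ := Set.not_subset.1 hKB
    exact ⟨x, hxK, (hKAB hxK).resolve_right hxB⟩
  · obtain ⟨x, hxK, hxA⟩ := Set.not_subset.1 hKA
    exact ⟨x, hxK, (hKAB hxK).resolve_left hxA⟩

/-- **Connected (nonempty compact) sets form a closed subset of the hyperspace
`NonemptyCompacts α`** (Hausdorff-metric topology): if `K = K₁ ∪ K₂` with compact pieces having
disjoint `δ`-thickenings, every compact set at Hausdorff distance `< δ` from `K` lies in the
union of the two thickenings and meets both, so it is not preconnected either.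
[cite: Molchanov2005, App. C (closed subsets of the space of compact sets)] -/
theorem isClosed_setOf_isPreconnected :
    IsClosed {K : NonemptyCompacts α | IsPreconnected (K : Set α)} := by
  rw [← isOpen_compl_iff, Metric.isOpen_iff]
  intro K hK
  obtain ⟨K₁, K₂, hK₁, hK₂, hd, hKeq, hne₁, hne₂⟩ :=
    exists_isCompact_union_of_not_isPreconnected K.isCompact hK
  obtain ⟨δ, hδ, hδd⟩ := hd.exists_thickenings hK₁ hK₂.isClosed
  refine ⟨δ, hδ, fun K' hK' => ?_⟩
  rw [Metric.mem_ball, Metric.NonemptyCompacts.dist_eq] at hK'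
  have hfin : hausdorffEDist (K' : Set α) (K : Set α) ≠ ⊤ :=
    hausdorffEDist_ne_top_of_nonempty_of_bounded K'.nonempty K.nonempty
      K'.isCompact.isBounded K.isCompact.isBounded
  have hfin' : hausdorffEDist (K : Set α) (K' : Set α) ≠ ⊤ := by
    rwa [hausdorffEDist_comm]
  -- `K'` lies in the union of the two thickenings
  have hsub : (K' : Set α) ⊆ thickening δ K₁ ∪ thickening δ K₂ := by
    intro x hx
    obtain ⟨y, hy, hxy⟩ := exists_dist_lt_of_hausdorffDist_lt hx hK' hfin
    rw [hKeq] at hy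
    rcases hy with hy | hy
    · exact Or.inl (mem_thickening_iff.2 ⟨y, hy, hxy⟩)
    · exact Or.inr (mem_thickening_iff.2 ⟨y, hy, hxy⟩)
  -- and meets both
  have hmeet : ∀ {L : Set α}, L ⊆ (K : Set α) → L.Nonempty →
      ((K' : Set α) ∩ thickening δ L).Nonempty := by
    intro L hL ⟨y, hy⟩
    have hK'' : hausdorffDist (K : Set α) (K' : Set α) < δ := by rwa [hausdorffDist_comm]
    obtain ⟨x, hx, hyx⟩ := exists_dist_lt_of_hausdorffDist_lt (hL hy) hK'' hfin'
    exact ⟨x, hx, mem_thickening_iff.2 ⟨y, hy, by rwa [dist_comm]⟩⟩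
  intro hK'c
  have h1 : K₁ ⊆ (K : Set α) := by rw [hKeq]; exact subset_union_left
  have h2 : K₂ ⊆ (K : Set α) := by rw [hKeq]; exact subset_union_right
  obtain ⟨x, -, hx₁, hx₂⟩ := hK'c _ _ isOpen_thickening isOpen_thickening hsub
    (hmeet h1 hne₁) (hmeet h2 hne₂)
  exact Set.disjoint_left.1 hδd hx₁ hx₂

end Connected

/-! ### Laws carried by one compact set: weakly convergent subsequences -/

section Laws

variable {X : Type*} [MetricSpace X] [MeasurableSpace X]

/-- **Probability measures all carried by one compact set are tight**, trivially. [folklore] -/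
theorem isTightMeasureSet_of_measure_compl_eq_zero {C : Set X} (hC : IsCompact C)
    (P : ℕ → ProbabilityMeasure X) (hP : ∀ n, (P n : Measure X) Cᶜ = 0) :
    IsTightMeasureSet {μ : Measure X | ∃ n, (P n : Measure X) = μ} := by
  rw [isTightMeasureSet_iff_exists_isCompact_measure_compl_le]
  intro ε _
  refine ⟨C, hC, ?_⟩
  rintro μ ⟨n, rfl⟩
  rw [hP n]
  exact zero_le

/-- **Weakly convergent subsequences for free**: a sequence of probability measures on a
separable metric space, all carried by one compact set `C`, has a weakly convergent subsequence
(Prokhorov's theorem, Mathlib's `isCompact_closure_of_isTightMeasureSet`, and the metrisability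
of weak convergence). [cite: Billingsley1999, Thm 5.1] -/
theorem exists_tendsto_subseq_of_measure_compl_eq_zero [SecondCountableTopology X] [BorelSpace X]
    {C : Set X} (hC : IsCompact C)
    (P : ℕ → ProbabilityMeasure X) (hP : ∀ n, (P n : Measure X) Cᶜ = 0) :
    ∃ ν : ProbabilityMeasure X, ∃ φ : ℕ → ℕ, StrictMono φ ∧ Tendsto (P ∘ φ) atTop (𝓝 ν) := by
  have hcpt : IsCompact (closure (Set.range P)) := by
    apply isCompact_closure_of_isTightMeasureSet
    refine (isTightMeasureSet_of_measure_compl_eq_zero hC P hP).subset ?_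
    rintro _ ⟨μ, ⟨n, rfl⟩, rfl⟩
    exact ⟨n, rfl⟩
  obtain ⟨ν, -, φ, hφ, hconv⟩ := hcpt.tendsto_subseq (x := P) fun n => subset_closure ⟨n, rfl⟩
  exact ⟨ν, φ, hφ, hconv⟩

/-! ### The two portmanteau inequalities along a convergent sequence -/

variable [BorelSpace X] {ι : Type*} {L : Filter ι} {P : ι → ProbabilityMeasure X}
  {ν : ProbabilityMeasure X}

/-- **Closed half of the portmanteau theorem, transfer form**: if `P_i → ν` weakly, `F` is closed
and eventually `u_i ≤ P_i(F)` with `u_i → q`, then `q ≤ ν(F)`.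
[cite: Billingsley1999, Thm 2.1 (iii)] -/
theorem le_measure_of_tendsto_of_isClosed [NeBot L] (h : Tendsto P L (𝓝 ν)) {F : Set X}
    (hF : IsClosed F) {u : ι → ℝ≥0∞} {q : ℝ≥0∞} (hu : Tendsto u L (𝓝 q))
    (hle : ∀ᶠ i in L, u i ≤ (P i : Measure X) F) : q ≤ (ν : Measure X) F := by
  have h1 : limsup u L ≤ limsup (fun i => (P i : Measure X) F) L :=
    limsup_le_limsup hle
  rw [hu.limsup_eq] at h1
  exact h1.trans (ProbabilityMeasure.limsup_measure_closed_le_of_tendsto h hF)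

/-- **Open half of the portmanteau theorem, transfer form**: if `P_i → ν` weakly, `G` is open
and eventually `P_i(G) ≤ u_i` with `u_i → r`, then `ν(G) ≤ r`.
[cite: Billingsley1999, Thm 2.1 (iv)] -/
theorem measure_le_of_tendsto_of_isOpen [NeBot L] (h : Tendsto P L (𝓝 ν)) {G : Set X}
    (hG : IsOpen G) {u : ι → ℝ≥0∞} {r : ℝ≥0∞} (hu : Tendsto u L (𝓝 r))
    (hle : ∀ᶠ i in L, (P i : Measure X) G ≤ u i) : (ν : Measure X) G ≤ r := by
  have h1 : liminf (fun i => (P i : Measure X) G) L ≤ liminf u L :=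
    liminf_le_liminf hle
  rw [hu.liminf_eq] at h1
  exact (ProbabilityMeasure.le_liminf_measure_open_of_tendsto h hG).trans h1

/-- **Closed sure events pass to the limit**: if `F` is closed and eventually `P_i(F) = 1`, then
`ν(F) = 1`. [cite: Billingsley1999, Thm 2.1 (iii)] -/
theorem measure_eq_one_of_tendsto_of_isClosed [NeBot L] (h : Tendsto P L (𝓝 ν)) {F : Set X}
    (hF : IsClosed F) (hle : ∀ᶠ i in L, (P i : Measure X) F = 1) : (ν : Measure X) F = 1 := by
  refine le_antisymm prob_le_one ?_
  exact le_measure_of_tendsto_of_isClosed h hF tendsto_const_nhds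
    (hle.mono fun i hi => hi.symm.le)

/-- Almost-sure form: if `F` is closed and eventually `P_i(F) = 1`, then `ν`-a.e. point lies in
`F`. [cite: Billingsley1999, Thm 2.1 (iii)] -/
theorem ae_mem_of_tendsto_of_isClosed [NeBot L] (h : Tendsto P L (𝓝 ν)) {F : Set X}
    (hF : IsClosed F) (hle : ∀ᶠ i in L, (P i : Measure X) F = 1) : ∀ᵐ x ∂(ν : Measure X), x ∈ F := by
  have h1 : (ν : Measure X) Fᶜ = 0 :=
    (prob_compl_eq_zero_iff hF.measurableSet).2 (measure_eq_one_of_tendsto_of_isClosed h hF hle)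
  rw [ae_iff]
  exact h1

end Laws

/-! ### Closed events of the hyperspace used by the range identification -/

section Hyperspace

variable {α : Type*} [MetricSpace α]

/-- The event "`K` meets the closed ball `closedBall p ε`" is closed in the hyperspace. [folklore] -/
theorem isClosed_setOf_inter_closedBall_nonempty (p : α) (ε : ℝ) :
    IsClosed {K : NonemptyCompacts α | ((K : Set α) ∩ closedBall p ε).Nonempty} :=
  NonemptyCompacts.isClosed_inter_nonempty_of_isClosed isClosed_closedBall

/-- **A compact set meeting every closed ball about `p` contains `p`.** [folklore] -/
theorem mem_of_forall_inter_closedBall_nonempty {K : NonemptyCompacts α} {p : α}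
    (h : ∀ n : ℕ, ((K : Set α) ∩ closedBall p (1 / ((n : ℝ) + 1))).Nonempty) : p ∈ (K : Set α) := by
  by_contra hp
  obtain ⟨ε, hε, hball⟩ := Metric.isOpen_iff.1 K.isCompact.isClosed.isOpen_compl p hp
  obtain ⟨n, hn⟩ := exists_nat_one_div_lt hε
  obtain ⟨x, hxK, hx⟩ := h n
  refine hball ?_ hxK
  rw [mem_closedBall] at hx
  exact mem_ball.2 (hx.trans_lt hn)

/-- The event "`q ∈ K`" is closed in the hyperspace. [folklore] -/
theorem isClosed_setOf_mem_coe (q : α) : IsClosed {K : NonemptyCompacts α | q ∈ (K : Set α)} := by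
  have : {K : NonemptyCompacts α | q ∈ (K : Set α)} =
      {K : NonemptyCompacts α | ((K : Set α) ∩ {q}).Nonempty} := by
    ext K
    simp [Set.inter_singleton_nonempty]
  rw [this]
  exact NonemptyCompacts.isClosed_inter_nonempty_of_isClosed isClosed_singleton

/-- The event "`K ⊆ F`" is closed in the hyperspace for `F` closed (Mathlib). [folklore] -/
theorem isClosed_setOf_coe_subset {F : Set α} (hF : IsClosed F) :
    IsClosed {K : NonemptyCompacts α | (K : Set α) ⊆ F} :=
  NonemptyCompacts.isClosed_subsets_of_isClosed hF

/-- The event "`K ⊆ C`" is compact in the hyperspace for `C` compact (Blaschke; Mathlib).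
[cite: Molchanov2005, App. C (Blaschke selection theorem)] -/
theorem isCompact_setOf_coe_subset {C : Set α} (hC : IsCompact C) :
    IsCompact {K : NonemptyCompacts α | (K : Set α) ⊆ C} :=
  NonemptyCompacts.isCompact_subsets_of_isCompact hC

variable [MeasurableSpace (NonemptyCompacts α)] [BorelSpace (NonemptyCompacts α)]
  {ι : Type*} {L : Filter ι} {P : ι → ProbabilityMeasure (NonemptyCompacts α)}
  {ν : ProbabilityMeasure (NonemptyCompacts α)}

/-- **Points `p_i → p` lying surely on the approximating random sets lie almost surely on the
limit set**: the closed events "`K` meets `closedBall p (1/(n+1))`" are eventually sure.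
[cite: Billingsley1999, Thm 2.1 (iii)] -/
theorem ae_mem_coe_of_tendsto [NeBot L] (h : Tendsto P L (𝓝 ν)) {p : ι → α} {p₀ : α}
    (hp : Tendsto p L (𝓝 p₀))
    (hsure : ∀ᶠ i in L, (P i : Measure (NonemptyCompacts α))
      {K : NonemptyCompacts α | p i ∈ (K : Set α)} = 1) :
    ∀ᵐ (K : NonemptyCompacts α) ∂(ν : Measure (NonemptyCompacts α)), p₀ ∈ (K : Set α) := by
  have key : ∀ n : ℕ, ∀ᵐ (K : NonemptyCompacts α) ∂(ν : Measure (NonemptyCompacts α)),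
      ((K : Set α) ∩ closedBall p₀ (1 / ((n : ℝ) + 1))).Nonempty := by
    intro n
    have hn : (0 : ℝ) < 1 / ((n : ℝ) + 1) := by positivity
    refine ae_mem_of_tendsto_of_isClosed h (isClosed_setOf_inter_closedBall_nonempty p₀ _) ?_
    filter_upwards [hsure, hp.eventually (closedBall_mem_nhds p₀ hn)] with i hi hpi
    refine le_antisymm prob_le_one ?_
    rw [← hi]
    exact measure_mono fun K hK => ⟨p i, hK, hpi⟩
  rw [← ae_all_iff] at key
  filter_upwards [key] with K hK
  exact mem_of_forall_inter_closedBall_nonempty hK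

end Hyperspace

/-! ### Registered form (part 1a of `stub_rangeIdentification`) -/

/-- **Registered helper `rangeIdentification_hyperspaceSubseq`** (crux item
stmt-CriticalPhenomena-0808, line `root-locality-replaces-loewner`, stub `stub_rangeIdentification`,
part 1a): laws of random compact subsets of ONE compact set `C ⊆ ℂ` have weakly convergent
subsequences — the compactness of `{K | K ⊆ C}` in the hyperspace (Blaschke) and Prokhorov's
theorem; this is the "no tightness estimate" input of the range identification.
[cite: Billingsley1999, Thm 5.1] -/
theorem rangeIdentification_hyperspaceSubseq : ∀ [MeasurableSpace (TopologicalSpace.NonemptyCompacts ℂ)] [BorelSpace (TopologicalSpace.NonemptyCompacts ℂ)] (C : Set ℂ), IsCompact C → ∀ (P : ℕ → MeasureTheory.ProbabilityMeasure (TopologicalSpace.NonemptyCompacts ℂ)), (∀ n, (P n : MeasureTheory.Measure (TopologicalSpace.NonemptyCompacts ℂ)) {K : TopologicalSpace.NonemptyCompacts ℂ | (K : Set ℂ) ⊆ C}ᶜ = 0) → ∃ ν : MeasureTheory.ProbabilityMeasure (TopologicalSpace.NonemptyCompacts ℂ), ∃ φ : ℕ → ℕ, StrictMono φ ∧ Filter.Tendsto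 (P ∘ φ) Filter.atTop (nhds ν) :=
  fun _ hC P hP => exists_tendsto_subseq_of_measure_compl_eq_zero (isCompact_setOf_coe_subset hC) P hP

end Summit.CriticalPhenomena.SAWScalingLimit.Theorems.HexConjecture.RootLocality.Range

end
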